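import Mathlib
import HarnessLib
import Summits.Ventures.LatticeQCDFlow.Scoring.ReplicaChainsBurnIn
import Summits.Ventures.LatticeQCDFlow.Scoring.EmpiricalErrorBar
import Summits.Ventures.LatticeQCDFlow.Scoring.FlowSamplerAutocorrelation

/-!
# The exact flow sampler in production — UNCONDITIONAL on `SU(n)^E`: `R` streams × burn-in `B` ×
# `N` kept configurations have a certified mean-square error, and one stream certifies its own
# error bar from its plug-in variance, both from cold starts, with `ε = e^{−2δ}`

HONEST FRAMING: exact (Metropolis-corrected) sampling algorithms for lattice gauge theory;
figures of merit are autocorrelation/cost numbers at stated couplings and volumes; no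
continuum-physics claim.

Venture `LatticeQCDFlow` (cell pub-lqcd), topic `Scoring`; FANOUT row 8 (`s0-cpn-nemc`, GEN-14).
NEW WORK of the cell, not a published result; no definition is introduced.  The composition of
`Scoring/ReplicaChainsBurnIn.lean` (`replicaChains_burnIn_mse_le_of_doeblin`) and
`Scoring/EmpiricalErrorBar.lean` (`chain_empirical_errorBar_of_doeblin`) with the tree's exact
flow-MCMC theorem `Exactness.flowSampler_exact_doeblin` (row 30 / lean-2, UNCONDITIONAL via
`jacobianFormula_holds`: Doeblin constant `e^{−2δ}` from a uniform defect `δ` of Lüscher's flow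
equation).  Nothing is cited as a fact.

## Content (hypotheses of `Scoring.flowSampler_autocorrelation`; `K = indepMH q w` EXACT for
## `π = 𝒵⁻¹e^{−S}D[U]`; `|f| ≤ C`, `C' = C + |πf|`, `Var_π f = ∫ (f − πf)² dπ`)

* **`flowSampler_production`** — `R ≥ 1` pairwise independent streams with arbitrary starts, each
  discarding `B` and keeping `N ≥ 1` configurations, on any probability space carrying them:
  `E[(grand mean − πf)²] ≤ ((2e^{2δ} − 1) Var_π f/N + 16 C'² e^{4δ} (1 − e^{−2δ}/2)^B/N²)/R
   + (1 − 1/R)(2C' e^{2δ} (1 − e^{−2δ}/2)^B/N)²`;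
* **`flowSampler_empiricalErrorBar`** — ONE stream from ANY start, `N ≥ 1`, `s > 0`, `η₀ > 0`,
  `0 < η ≤ 1`, `V̂_N` the plug-in variance of the run, `Δ` the data-free radii of
  `Scoring/EmpiricalErrorBar.lean` at `e = e^{−2δ}`:
  `P(s ≤ |A_N − πf| ∧ (2e^{2δ} − 1)(V̂_N + Δ)/N + 64 C² e^{4δ}/N² ≤ η₀ s²) ≤ η₀ + 2η`.

Reading (value-free): a certified defect `δ` turns the three production knobs (streams, burn-in,
kept length) into an honest error budget from cold starts, and lets a single stream print a
certified error bar from its own plug-in variance — the leading term variance-driven, every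
constant explicit in `δ`.  NOT CLAIMED: any value of `δ`; optimal knob settings; Bernstein-type
confidence; unbounded observables.
-/

noncomputable section

namespace Summit.Ventures.LatticeQCDFlow.Scoring

open MeasureTheory ProbabilityTheory Filter Finset Summit.Ventures.LatticeQCDFlow.Exactness
open Literature.MathematicalPhysics.QuantumFieldTheory
open Literature.MathematicalPhysics.QuantumFieldTheory.Luscher2010
open Summit.Ventures.LatticeQCDFlow.TrivializingMaps
open scoped ENNReal Matrix Matrix.Norms.Frobenius ContDiff

variable {d L n : ℕ} [NeZero L]

/-- **`R` streams × burn-in `B` × `N` kept, for the exact flow sampler — UNCONDITIONAL.**  See the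
module docstring. -/
theorem flowSampler_production (Bs : SuBasis n)
    {S : AmbConfig d L n → ℝ} (hS : ContDiff ℝ ∞ S) {F : ℝ → AmbConfig d L n → ℝ}
    (hF : ContDiff ℝ ∞ fun p : ℝ × AmbConfig d L n => F p.1 p.2)
    {Φ : ℝ → GaugeConfig d L (Matrix.specialUnitaryGroup (Fin n) ℂ) →
      GaugeConfig d L (Matrix.specialUnitaryGroup (Fin n) ℂ)}
    (hΦ : IsFlowMap (fun t W => -linkGrad Bs (F t) W) Φ) {c : ℝ → ℝ} {δ : ℝ}
    (hδ : ∀ t ∈ Set.Icc (0 : ℝ) 1, ∀ U : GaugeConfig d L (Matrix.specialUnitaryGroup (Fin n) ℂ),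
      |luscherL Bs S t (F t) (WilsonFlow.coeConfig U) - S (WilsonFlow.coeConfig U) - c t| ≤ δ)
    (q : Measure (GaugeConfig d L (Matrix.specialUnitaryGroup (Fin n) ℂ))) [IsProbabilityMeasure q]
    (hq : q = Measure.map (Φ 1) (trivialMeasure (Matrix.specialUnitaryGroup (Fin n) ℂ) d L)) :
    ∃ w : GaugeConfig d L (Matrix.specialUnitaryGroup (Fin n) ℂ) → ℝ, ∃ hw : Measurable w,
      (q.withDensity fun U => ENNReal.ofReal (w U)) =
        boltzmannMeasure (fun U : GaugeConfig d L (Matrix.specialUnitaryGroup (Fin n) ℂ) =>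
          S (WilsonFlow.coeConfig U)) ∧
      Kernel.Invariant (indepMH q w)
        (boltzmannMeasure fun U : GaugeConfig d L (Matrix.specialUnitaryGroup (Fin n) ℂ) =>
          S (WilsonFlow.coeConfig U)) ∧
      ∀ {Ω' : Type*} [MeasurableSpace Ω'] (μ : Measure Ω') [IsProbabilityMeasure μ]
        (X : ℕ → Ω' → (ℕ → GaugeConfig d L (Matrix.specialUnitaryGroup (Fin n) ℂ)))
        (μ₀ : ℕ → Measure (GaugeConfig d L (Matrix.specialUnitaryGroup (Fin n) ℂ)))
        [∀ r, IsProbabilityMeasure (μ₀ r)] (R : ℕ), R ≠ 0 → (∀ r, Measurable (X r)) →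
        haveI : Fact (Measurable w) := ⟨hw⟩
        (∀ r < R, μ.map (X r) = Kernel.trajMeasure
            (X := fun _ : ℕ => GaugeConfig d L (Matrix.specialUnitaryGroup (Fin n) ℂ)) (μ₀ r)
            (fun j : ℕ => (indepMH q w).comap
              (fun y : (i : ↥(Finset.Iic j)) → GaugeConfig d L (Matrix.specialUnitaryGroup (Fin n) ℂ) =>
                y ⟨j, Finset.mem_Iic.2 le_rfl⟩) (measurable_pi_apply _))) →
        (∀ i < R, ∀ j < R, i ≠ j → IndepFun (X i) (X j) μ) →
        ∀ (f : GaugeConfig d L (Matrix.specialUnitaryGroup (Fin n) ℂ) → ℝ), Measurable f →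
          ∀ C : ℝ, (∀ U, |f U| ≤ C) → ∀ (B : ℕ) (N : ℕ), N ≠ 0 →
          let π := boltzmannMeasure fun U : GaugeConfig d L (Matrix.specialUnitaryGroup (Fin n) ℂ) =>
            S (WilsonFlow.coeConfig U)
          ∫ xs, (replicaMean (fun r xs => (∑ i ∈ Finset.range N, f (X r xs (B + i))) / N) R xs
              - ∫ V, f V ∂π) ^ 2 ∂μ
            ≤ ((2 * Real.exp (2 * δ) - 1) * (∫ V, (f V - ∫ V', f V' ∂π) ^ 2 ∂π) / N
                  + 16 * (C + |∫ V, f V ∂π|) ^ 2 * Real.exp (4 * δ)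
                    * (1 - Real.exp (-(2 * δ)) / 2) ^ B / (N : ℝ) ^ 2) / R
              + (1 - 1 / R) * (2 * (C + |∫ V, f V ∂π|) * Real.exp (2 * δ)
                  * (1 - Real.exp (-(2 * δ)) / 2) ^ B / N) ^ 2 := by
  obtain ⟨w, hw, -, -, hπ, hinv, -, hdoeb⟩ := flowSampler_exact_doeblin Bs hS hF hΦ hδ q hq
  haveI : Fact (Measurable w) := ⟨hw⟩
  have hS'c : Continuous fun U : GaugeConfig d L (Matrix.specialUnitaryGroup (Fin n) ℂ) =>
      S (WilsonFlow.coeConfig U) := hS.continuous.comp WilsonFlow.continuous_coeConfig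
  haveI := isProbabilityMeasure_boltzmannMeasure (d := d) (L := L) hS'c
  have hε0 : 0 < ENNReal.ofReal (Real.exp (-(2 * δ))) := ENNReal.ofReal_pos.2 (Real.exp_pos _)
  have hr : (ENNReal.ofReal (Real.exp (-(2 * δ)))).toReal = Real.exp (-(2 * δ)) :=
    ENNReal.toReal_ofReal (Real.exp_pos _).le
  have hr2 : (ENNReal.ofReal (Real.exp (-(2 * δ))) / 2).toReal = Real.exp (-(2 * δ)) / 2 := by
    rw [ENNReal.toReal_div, hr, ENNReal.toReal_ofNat]
  refine ⟨w, hw, hπ, hinv, fun μ _ X μ₀ _ R hR hXm hlaw hind f hf C hC B N hN => ?_⟩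
  have h := replicaChains_burnIn_mse_le_of_doeblin (κ := indepMH q w) (μ := μ) (X := X) (μ₀ := μ₀)
    hinv (fun x A hA => hdoeb x hA) hε0 hf hC B hN hR hXm hlaw hind
  rw [hr, hr2] at h
  refine h.trans (le_of_eq ?_)
  have he2 : Real.exp (2 * δ) = (Real.exp (-(2 * δ)))⁻¹ := by rw [Real.exp_neg, inv_inv]
  have h4 : Real.exp (4 * δ) = Real.exp (2 * δ) ^ 2 := by rw [← Real.exp_nat_mul]; ring_nf
  have hene : Real.exp (-(2 * δ)) ≠ 0 := (Real.exp_pos _).ne'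
  have hNne : (N : ℝ) ≠ 0 := by exact_mod_cast hN
  rw [h4, he2]
  field_simp

/-- **One stream certifies its own error bar — UNCONDITIONAL, any start.**  See the module
docstring. -/
theorem flowSampler_empiricalErrorBar (Bs : SuBasis n)
    {S : AmbConfig d L n → ℝ} (hS : ContDiff ℝ ∞ S) {F : ℝ → AmbConfig d L n → ℝ}
    (hF : ContDiff ℝ ∞ fun p : ℝ × AmbConfig d L n => F p.1 p.2)
    {Φ : ℝ → GaugeConfig d L (Matrix.specialUnitaryGroup (Fin n) ℂ) →
      GaugeConfig d L (Matrix.specialUnitaryGroup (Fin n) ℂ)}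
    (hΦ : IsFlowMap (fun t W => -linkGrad Bs (F t) W) Φ) {c : ℝ → ℝ} {δ : ℝ}
    (hδ : ∀ t ∈ Set.Icc (0 : ℝ) 1, ∀ U : GaugeConfig d L (Matrix.specialUnitaryGroup (Fin n) ℂ),
      |luscherL Bs S t (F t) (WilsonFlow.coeConfig U) - S (WilsonFlow.coeConfig U) - c t| ≤ δ)
    (q : Measure (GaugeConfig d L (Matrix.specialUnitaryGroup (Fin n) ℂ))) [IsProbabilityMeasure q]
    (hq : q = Measure.map (Φ 1) (trivialMeasure (Matrix.specialUnitaryGroup (Fin n) ℂ) d L)) :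
    ∃ w : GaugeConfig d L (Matrix.specialUnitaryGroup (Fin n) ℂ) → ℝ, ∃ hw : Measurable w,
      (q.withDensity fun U => ENNReal.ofReal (w U)) =
        boltzmannMeasure (fun U : GaugeConfig d L (Matrix.specialUnitaryGroup (Fin n) ℂ) =>
          S (WilsonFlow.coeConfig U)) ∧
      Kernel.Invariant (indepMH q w)
        (boltzmannMeasure fun U : GaugeConfig d L (Matrix.specialUnitaryGroup (Fin n) ℂ) =>
          S (WilsonFlow.coeConfig U)) ∧
      ∀ (μ₀ : Measure (GaugeConfig d L (Matrix.specialUnitaryGroup (Fin n) ℂ))) [IsProbabilityMeasure μ₀]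
        (f : GaugeConfig d L (Matrix.specialUnitaryGroup (Fin n) ℂ) → ℝ), Measurable f →
        ∀ C : ℝ, (∀ U, |f U| ≤ C) → ∀ N : ℕ, N ≠ 0 → ∀ η : ℝ, 0 < η → η ≤ 1 →
        ∀ η₀ : ℝ, 0 < η₀ → ∀ s : ℝ, 0 < s →
        let π := boltzmannMeasure fun U : GaugeConfig d L (Matrix.specialUnitaryGroup (Fin n) ℂ) =>
          S (WilsonFlow.coeConfig U)
        haveI : Fact (Measurable w) := ⟨hw⟩
        (Kernel.trajMeasure (X := fun _ : ℕ => GaugeConfig d L (Matrix.specialUnitaryGroup (Fin n) ℂ))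
              μ₀ (fun m : ℕ => (indepMH q w).comap
                (fun y : (i : ↥(Finset.Iic m)) → GaugeConfig d L (Matrix.specialUnitaryGroup (Fin n) ℂ) =>
                  y ⟨m, Finset.mem_Iic.2 le_rfl⟩) (measurable_pi_apply _))).real
            {x | s ≤ |(∑ i ∈ Finset.range N, f (x i)) / N - ∫ V, f V ∂π| ∧
              (2 / Real.exp (-(2 * δ)) - 1)
                  * (((∑ i ∈ Finset.range N, f (x i) ^ 2) / N
                      - ((∑ i ∈ Finset.range N, f (x i)) / N) ^ 2)
                    + ((8 * C ^ 2 / (Real.exp (-(2 * δ)) * N)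
                        + Real.sqrt (32 * C ^ 4 * Real.log (2 / η) / (Real.exp (-(2 * δ)) ^ 2 * N)))
                      + 2 * C * (8 * C / (Real.exp (-(2 * δ)) * N)
                        + Real.sqrt (32 * C ^ 2 * Real.log (2 / η)
                            / (Real.exp (-(2 * δ)) ^ 2 * N))))) / N
                + 64 * C ^ 2 / (Real.exp (-(2 * δ)) ^ 2 * (N : ℝ) ^ 2)
                ≤ η₀ * s ^ 2}
          ≤ η₀ + 2 * η := by
  obtain ⟨w, hw, -, -, hπ, hinv, -, hdoeb⟩ := flowSampler_exact_doeblin Bs hS hF hΦ hδ q hq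
  haveI : Fact (Measurable w) := ⟨hw⟩
  have hS'c : Continuous fun U : GaugeConfig d L (Matrix.specialUnitaryGroup (Fin n) ℂ) =>
      S (WilsonFlow.coeConfig U) := hS.continuous.comp WilsonFlow.continuous_coeConfig
  haveI := isProbabilityMeasure_boltzmannMeasure (d := d) (L := L) hS'c
  have hε0 : 0 < ENNReal.ofReal (Real.exp (-(2 * δ))) := ENNReal.ofReal_pos.2 (Real.exp_pos _)
  have hr : (ENNReal.ofReal (Real.exp (-(2 * δ)))).toReal = Real.exp (-(2 * δ)) :=
    ENNReal.toReal_ofReal (Real.exp_pos _).le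
  refine ⟨w, hw, hπ, hinv, fun μ₀ _ f hf C hC N hN η hη0 hη1 η₀ hη₀ s hs => ?_⟩
  have h := chain_empirical_errorBar_of_doeblin (κ := indepMH q w) (μ₀ := μ₀) hinv
    (fun x A hA => hdoeb x hA) hε0 hf hC hN hη0 hη1 hη₀ hs
  rw [hr] at h
  exact h

end Summit.Ventures.LatticeQCDFlow.Scoring

end
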